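import Mathlib.NumberTheory.Chebyshev
import Mathlib.NumberTheory.Primorial
import Mathlib.Analysis.SpecialFunctions.Log.Basic
import Mathlib.Analysis.SpecialFunctions.Pow.Real
import Mathlib.Analysis.Complex.ExponentialBounds
import HarnessLib

/-!
# An explicit (effective) lower bound for Chebyshev's `θ`: `θ(x) ≥ x/4` for all real `x ≥ 3`

`θ(x) = Σ_{p ≤ x} log p` is Mathlib's `Chebyshev.theta`. Mathlib proves the Chebyshev UPPER bound `θ(x) ≤ (log 4)·x`
(`Chebyshev.theta_le_log4_mul_x`) and the explicit LOWER bound `(x − 1)·log 2 − log(x + 2) − 2·√x·log x ≤ θ(x)`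
(`Chebyshev.theta_ge'`), which is only useful for large `x` (it is negative below `x ≈ 300` and reaches `x/4` only
near `x ≈ 1000`). This file closes the gap down to `x = 3` and records ONE clean effective statement:

* `quarter_le_theta : 3 ≤ x → x/4 ≤ θ(x)` (the constant `1/4` and the threshold `3` are not optimal — Rosser–Schoenfeld
  give `θ(x) > 0.84·x` for `x ≥ 101` — but they are what the cheap argument yields; `θ(x) < x/4` does happen on
  `(4·log 2, 3) ≈ (2.77, 3)`, so the threshold `3` cannot be lowered to `2`);
* its standard consequence, an EFFECTIVE prime-avoidance lemma: for a finite set `A ⊆ ℕ` and `x ≥ 3` with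
  `Σ_{p ∈ A} log p < x/4` there is a prime `p ∉ A` with `p ≤ x` (`exists_prime_not_mem_le_of_sum_log_lt_quarter`); in
  particular `p ≤ 4·Σ_{p∈A} log p + 3` (`exists_prime_not_mem_le`). (Compare the INEFFECTIVE «there exists ξ_prm with
  (2/3)x ≤ θ(x) for x ≥ ξ_prm» obtained from the prime number theorem, e.g. `Literature.IUT.LogVolume.exists_isXiPrm`.)

METHOD. For `x ≥ 1700`: Mathlib's `theta_ge'` together with `log x ≤ 2·log 41.23 + 2(√x/41.23 − 1)` (concavity at
`√1700 ≥ 41.23`) and `√x ≤ x/41.23` gives `θ(x) ≥ 0.327·x − 6.9 ≥ x/4`. For `3 ≤ x ≤ 1700`: seven kernel-checked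
CHECKPOINTS `2^k ≤ primorial n` (`(n,k) = (3,2), (5,4), (11,11), (29,32), (83,107), (229,303), (457,622)`, each by
`decide +kernel`, the last ≈ 6 s of kernel time) give `θ(n) = log(primorial n) ≥ k·log 2`, and monotonicity of `θ`
carries `x/4 ≤ θ(x)` across `[n, 4k·log 2] ⊇ [n, n′]` for consecutive checkpoints `n < n′`.

Everything here is [folklore] (Chebyshev 1852-type bounds; the numerical constants are ours). No `sorry`, standard axioms.
-/

noncomputable section

open Real Finset Nat
open scoped Chebyshev

namespace Literature.NumberTheory.Multiplicative

/-! ## 1. Checkpoints: `θ(n) ≥ k·log 2` from `2^k ≤ primorial n` -/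

/-- Certificate reader: `2^k ≤ n# ⟹ k·log 2 ≤ θ(n)` (`θ(n) = log(n#)`, Mathlib `Chebyshev.theta_eq_log_primorial`).
[folklore] -/
private theorem mul_log_two_le_theta_of_pow_le_primorial {n k : ℕ} (h : 2 ^ k ≤ primorial n) :
    (k : ℝ) * Real.log 2 ≤ θ (n : ℝ) := by
  rw [Chebyshev.theta_eq_log_primorial, Nat.floor_natCast, ← Real.log_pow]
  exact Real.log_le_log (by positivity) (by exact_mod_cast h)

/-- Propagation: a checkpoint `2^k ≤ n#` gives `x/4 ≤ θ(x)` for every real `x` with `n ≤ x ≤ 4k·(0.6931471803)`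
(`θ` is monotone, `log 2 > 0.6931471803`). [folklore] -/
private theorem quarter_le_theta_of_checkpoint {n k : ℕ} (h : 2 ^ k ≤ primorial n) {x : ℝ} (hnx : (n : ℝ) ≤ x)
    (hxk : x ≤ 4 * k * 0.6931471803) : x / 4 ≤ θ x := by
  have h1 := mul_log_two_le_theta_of_pow_le_primorial h
  have h2 : θ (n : ℝ) ≤ θ x := Chebyshev.theta_mono hnx
  have h3 : (k : ℝ) * 0.6931471803 ≤ (k : ℝ) * Real.log 2 :=
    mul_le_mul_of_nonneg_left Real.log_two_gt_d9.le (Nat.cast_nonneg k)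
  linarith

/-- Checkpoint `2² ≤ 3# = 6`. [folklore] -/
private theorem two_pow_2_le_primorial_3 : 2 ^ 2 ≤ primorial 3 := by decide +kernel

/-- Checkpoint `2⁴ ≤ 5# = 30`. [folklore] -/
private theorem two_pow_4_le_primorial_5 : 2 ^ 4 ≤ primorial 5 := by decide +kernel

/-- Checkpoint `2¹¹ ≤ 11# = 2310`. [folklore] -/
private theorem two_pow_11_le_primorial_11 : 2 ^ 11 ≤ primorial 11 := by decide +kernel

/-- Checkpoint `2³² ≤ 29# = 6469693230`. [folklore] -/
private theorem two_pow_32_le_primorial_29 : 2 ^ 32 ≤ primorial 29 := by decide +kernel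

/-- Checkpoint `2¹⁰⁷ ≤ 83#`. [folklore] -/
private theorem two_pow_107_le_primorial_83 : 2 ^ 107 ≤ primorial 83 := by decide +kernel

set_option exponentiation.threshold 1024 in
/-- Checkpoint `2³⁰³ ≤ 229#`. [folklore] -/
private theorem two_pow_303_le_primorial_229 : 2 ^ 303 ≤ primorial 229 := by decide +kernel

set_option exponentiation.threshold 1024 in
/-- Checkpoint `2⁶²² ≤ 457#` (i.e. `θ(457) ≥ 431.1`; kernel `decide`, ≈ 6 s). [folklore] -/
private theorem two_pow_622_le_primorial_457 : 2 ^ 622 ≤ primorial 457 := by decide +kernel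

/-- `x/4 ≤ θ(x)` on `[3, 1700]`, by the seven checkpoints. [folklore] -/
private theorem quarter_le_theta_of_le_1700 {x : ℝ} (h3 : 3 ≤ x) (h1700 : x ≤ 1700) : x / 4 ≤ θ x := by
  rcases le_or_gt x 5 with h | h
  · exact quarter_le_theta_of_checkpoint two_pow_2_le_primorial_3 (by norm_num; linarith) (by norm_num; linarith)
  rcases le_or_gt x 11 with h' | h'
  · exact quarter_le_theta_of_checkpoint two_pow_4_le_primorial_5 (by norm_num; linarith) (by norm_num; linarith)
  rcases le_or_gt x 29 with h'' | h''
  · exact quarter_le_theta_of_checkpoint two_pow_11_le_primorial_11 (by norm_num; linarith) (by norm_num; linarith)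
  rcases le_or_gt x 83 with h3' | h3'
  · exact quarter_le_theta_of_checkpoint two_pow_32_le_primorial_29 (by norm_num; linarith) (by norm_num; linarith)
  rcases le_or_gt x 229 with h4 | h4
  · exact quarter_le_theta_of_checkpoint two_pow_107_le_primorial_83 (by norm_num; linarith) (by norm_num; linarith)
  rcases le_or_gt x 457 with h5 | h5
  · exact quarter_le_theta_of_checkpoint two_pow_303_le_primorial_229 (by norm_num; linarith) (by norm_num; linarith)
  · exact quarter_le_theta_of_checkpoint two_pow_622_le_primorial_457 (by norm_num; linarith) (by norm_num; linarith)

/-! ## 2. The analytic range `x ≥ 1700` from Mathlib's `Chebyshev.theta_ge'` -/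

/-- `log 41.23 ≤ 3.7541735` (`41.23 = 2⁵·1.2884375`, `log 2 < 0.6931471808`, `log y ≤ y − 1`). [folklore] -/
private theorem log_4123_le : Real.log 41.23 ≤ 3.7541735 := by
  have h : (41.23 : ℝ) = 2 ^ 5 * 1.2884375 := by norm_num
  rw [h, Real.log_mul (by norm_num) (by norm_num), Real.log_pow]
  have h1 := Real.log_two_lt_d9
  have h2 : Real.log 1.2884375 ≤ 1.2884375 - 1 := Real.log_le_sub_one_of_pos (by norm_num)
  push_cast
  linarith

/-- For `s ≥ 41.23`: `log s ≤ 2.7541735 + s/41.23` (concavity of `log` at `41.23`). [folklore] -/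
private theorem log_le_of_ge_4123 {s : ℝ} (hs : 41.23 ≤ s) : Real.log s ≤ 2.7541735 + s / 41.23 := by
  have hs0 : 0 < s := by linarith
  have h1 : Real.log (s / 41.23) ≤ s / 41.23 - 1 := Real.log_le_sub_one_of_pos (by positivity)
  rw [Real.log_div hs0.ne' (by norm_num)] at h1
  have h2 := log_4123_le
  linarith

/-- `x/4 ≤ θ(x)` for `x ≥ 1700`: Mathlib's `θ(x) ≥ (x−1)·log 2 − log(x+2) − 2√x·log x` with `log x = 2·log √x ≤
2·(2.7541735 + √x/41.23)`, `log(x+2) ≤ log 2 + log x`, `√x ≥ 41.23`, `x = (√x)²` gives `θ(x) ≥ 0.327·x − 6.9`.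
[folklore] -/
private theorem quarter_le_theta_of_ge_1700 {x : ℝ} (hx : 1700 ≤ x) : x / 4 ≤ θ x := by
  have hx0 : 0 < x := by linarith
  have hθ := Chebyshev.theta_ge' (x := x) (by linarith)
  have hs : 41.23 ≤ Real.sqrt x := Real.le_sqrt_of_sq_le (by norm_num; linarith)
  have hs0 : 0 < Real.sqrt x := by linarith
  have hxs : Real.sqrt x * Real.sqrt x = x := Real.mul_self_sqrt hx0.le
  -- `41.23·√x ≤ x`
  have hD : 41.23 * Real.sqrt x ≤ x := by
    calc 41.23 * Real.sqrt x ≤ Real.sqrt x * Real.sqrt x := mul_le_mul_of_nonneg_right hs hs0.le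
      _ = x := hxs
  have hlogx : Real.log x = 2 * Real.log (Real.sqrt x) := by
    rw [Real.log_sqrt hx0.le]; ring
  have hlogs := log_le_of_ge_4123 hs
  have hL1 := Real.log_two_gt_d9
  have hL2 := Real.log_two_lt_d9
  -- `(x − 1)·log 2 ≥ (x − 1)·0.6931471803`
  have hA : (x - 1) * 0.6931471803 ≤ (x - 1) * Real.log 2 :=
    mul_le_mul_of_nonneg_left hL1.le (by linarith)
  -- `log(x + 2) ≤ log(2x) = log 2 + log x`
  have hB : Real.log (x + 2) ≤ Real.log 2 + 2 * Real.log (Real.sqrt x) := by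
    rw [← hlogx, ← Real.log_mul (by norm_num) hx0.ne']
    exact Real.log_le_log (by linarith) (by linarith)
  -- `2·√x·log x = 4·√x·log √x ≤ 4·√x·(2.7541735 + √x/41.23) = 11.016694·√x + (4/41.23)·x`
  have hC : 2 * Real.sqrt x * Real.log x ≤ 11.016694 * Real.sqrt x + 4 / 41.23 * x := by
    rw [hlogx]
    have h4 : 4 * Real.sqrt x * Real.log (Real.sqrt x) ≤ 4 * Real.sqrt x * (2.7541735 + Real.sqrt x / 41.23) :=
      mul_le_mul_of_nonneg_left hlogs (by positivity)
    have e1 : 4 * Real.sqrt x * (2.7541735 + Real.sqrt x / 41.23) =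
        11.016694 * Real.sqrt x + 4 / 41.23 * (Real.sqrt x * Real.sqrt x) := by ring
    have e2 : 2 * Real.sqrt x * (2 * Real.log (Real.sqrt x)) = 4 * Real.sqrt x * Real.log (Real.sqrt x) := by ring
    rw [hxs] at e1
    rw [e2]
    linarith [h4, e1]
  have h1 : (x - 1) * 0.6931471803 - (0.6931471808 + 2 * (2.7541735 + Real.sqrt x / 41.23))
      - (11.016694 * Real.sqrt x + 4 / 41.23 * x) ≤ θ x := by
    have e1 : (x - 1) * Real.log 2 - Real.log (x + 2) - 2 * Real.sqrt x * Real.log x ≤ θ x := hθ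
    nlinarith [e1, hA, hB, hlogs, hL2, hC]
  nlinarith [h1, hD, hx]

/-! ## 3. The effective bound and the effective prime-avoidance lemma -/

/-- **Effective Chebyshev lower bound**: `x/4 ≤ θ(x)` for every real `x ≥ 3` — a WEAK explicit form of Rosser–Schoenfeld,
*Approximate formulas for some functions of prime numbers* (Illinois J. Math. 6, 1962), Thm 4, Corollary (3.16) «x(1 − 1/log x)
< θ(x) for 41 ≤ x» and Thm 10 «cx < θ(x) for d ≤ x» (table of pairs (c, d)), proved here from scratch (Mathlib's `theta_ge'`
+ seven primorial checkpoints), not from the paper's zero-density inputs. (Sharp threshold for the constant `1/4`: `θ = log 2 <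
x/4` on `(4 log 2, 3)`.) [cite: RosserSchoenfeld1962, Thm 4 Cor. (3.16) / Thm 10 (weak explicit form c = 1/4, d = 3)] -/
-- TODO(general form): (3.16) `x(1 − 1/log x) < θ(x)` for `x ≥ 41`; Thm 10's table.
theorem quarter_le_theta {x : ℝ} (hx : 3 ≤ x) : x / 4 ≤ θ x := by
  rcases le_or_gt x 1700 with h | h
  · exact quarter_le_theta_of_le_1700 hx h
  · exact quarter_le_theta_of_ge_1700 h.le

/-- If every prime `≤ x` lies in `A`, then `θ(x) ≤ Σ_{p ∈ A} log p`. [folklore] -/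
private theorem theta_le_sum_log_of_forall_prime_le_mem {A : Finset ℕ} {x : ℝ}
    (h : ∀ p : ℕ, p.Prime → (p : ℝ) ≤ x → p ∈ A) : θ x ≤ ∑ p ∈ A, Real.log p := by
  rw [Chebyshev.theta_eq_sum_primesLE]
  refine Finset.sum_le_sum_of_subset_of_nonneg (fun p hp => ?_) (fun p _ _ => Real.log_natCast_nonneg p)
  rw [Nat.mem_primesLE] at hp
  refine h p hp.2 ?_
  rcases lt_or_ge x 0 with hx | hx
  · have : ⌊x⌋₊ = 0 := Nat.floor_of_nonpos hx.le
    rw [this] at hp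
    exact absurd hp.2 (by have := hp.1; interval_cases p; decide)
  · exact le_trans (by exact_mod_cast hp.1) (Nat.floor_le hx)

/-- If `Σ_{p ∈ A} log p < θ(x)`, some prime `p ≤ x` is missing from `A` — the mechanism of [GenEll] Lemma 4.1 / [IUTchIV]
Prop. 2.1 (ii) «there exists a prime number p ∉ A such that p ≤ …», here with `θ(x)` itself as the threshold quantity.
[cite: MochizukiGenEll2010, Lem 4.1 p.20 (mechanism; threshold form)] -/
theorem exists_prime_not_mem_le_of_sum_log_lt_theta {A : Finset ℕ} {x : ℝ} (h : ∑ p ∈ A, Real.log p < θ x) :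
    ∃ p : ℕ, p.Prime ∧ p ∉ A ∧ (p : ℝ) ≤ x := by
  by_contra hcon
  push Not at hcon
  have hall : ∀ p : ℕ, p.Prime → (p : ℝ) ≤ x → p ∈ A := fun p hp hpx => by
    by_contra hpA
    exact absurd (hcon p hp hpA) (not_lt.mpr hpx)
  exact absurd (theta_le_sum_log_of_forall_prime_le_mem hall) (not_le.mpr h)

/-- **Effective prime avoidance**: for `x ≥ 3` and a finite `A ⊆ ℕ` with `Σ_{p∈A} log p < x/4` there is a prime
`p ∉ A`, `p ≤ x` ([GenEll] Lemma 4.1 with `M = 1`, made EFFECTIVE by `quarter_le_theta`; the tree's ineffective form is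
`Literature.IUT.LogVolume.exists_prime_not_mem_le_of_isXiPrm`). [cite: MochizukiGenEll2010, Lem 4.1 p.20 (effective special
case M = 1)] -/
theorem exists_prime_not_mem_le_of_sum_log_lt_quarter {A : Finset ℕ} {x : ℝ} (hx : 3 ≤ x)
    (h : ∑ p ∈ A, Real.log p < x / 4) : ∃ p : ℕ, p.Prime ∧ p ∉ A ∧ (p : ℝ) ≤ x :=
  exists_prime_not_mem_le_of_sum_log_lt_theta (lt_of_lt_of_le h (quarter_le_theta hx))

/-- **Effective prime avoidance, closed form**: for every finite `A ⊆ ℕ` there is a prime `p ∉ A` with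
`p ≤ 4·Σ_{p∈A} log p + 3` ([GenEll] Lemma 4.1, `M = 1`, explicit constants). [cite: MochizukiGenEll2010, Lem 4.1 p.20
(effective special case M = 1, constants 4 and 3 ours)] -/
theorem exists_prime_not_mem_le (A : Finset ℕ) :
    ∃ p : ℕ, p.Prime ∧ p ∉ A ∧ (p : ℝ) ≤ 4 * ∑ q ∈ A, Real.log q + 3 := by
  have h0 : 0 ≤ ∑ q ∈ A, Real.log (q : ℝ) := Finset.sum_nonneg fun q _ => Real.log_natCast_nonneg q
  exact exists_prime_not_mem_le_of_sum_log_lt_quarter (by linarith) (by linarith)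

end Literature.NumberTheory.Multiplicative

end
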